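import Summits.AnomalousDissipation.AnomalousDissipation.Theorems.SawtoothPulseCascadeK1LocalisedCascadeBlockJunkCT

/-!
# K1loc — helper: THE SCALAR BOUNDS OF A FAMILY OF GEOMETRIC FIBRE BLOCKS, CORNER-TRACE GRADE, AGGREGATE TRACKED ENERGY
(closed forms; companion of `…BlockJunkCT`, finding F-p1g8-1)

The aggregate-energy class steps `…ClassBlocksCTE.tsum_class_{v,h}step_blocks_ctE_le` ask for four scalar bounds of the blocks
`m < M_b` (gap `D_m`, lobe `Q_m`, trace ratio `T_m`, rounding scale `Λ'_m = Λ_{m+1}G`):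
* the trace junk `Σ_m 3Nσ_m/π²·(2N·T_m) ≤ A`, `σ_m = 1/(D_m+Q_m)² + 1/(N(D_m+Q_m))`,
* the residue coefficient `12N²Q_m²(2Q_m/N + 1)σ_m/(π²D_m²) ≤ β*` (charged once against the total fibre energy `½`),
* the rounding coefficient `(πΛ'_mε/N)² ≤ ρ*` (likewise),
* the zone junk `Σ_m 8Mδ·T_m/π ≤ Z`.
On CANONICAL (dyadic) blocks — `D_m ≥ D₀2^m`, `D_m + Q_m ≥ S₀2^m`, `0 ≤ Q_m ≤ q₀2^m`, `0 ≤ T_m ≤ r*`, `0 ≤ Λ'_m ≤ ℓ₀2^{m+1}` — this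
file gives the closed forms
  `A = 6N²r*(4/(3S₀²) + 2/(NS₀))/π²` (`ctTrace_sum_le`),
  `β* = 12N²(q₀/D₀)²(2q₀/(NS₀²) + 2q₀/(N²S₀) + 1/S₀² + 1/(NS₀))/π²` (`ctResidue_le`, the worst block is the lowest),
  `ρ* = (πℓ₀2^{M_b}ε/N)²` (`ctRound_le`, the worst block is the top one), `Z = M_b·(8Mδ·r*/π)` (`ctZone_sum_le`).
Pure real arithmetic; no definitions; no statement about the crux. [cite: Grafakos2014, Prop. 3.2.7 (3)] [problem: turb]
-/

-- `Summit.<Summit>.<Problem>`: single-conjunct summit, the duplicate namespace segment is deliberate.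
set_option linter.dupNamespace false

noncomputable section

namespace Summit.AnomalousDissipation.AnomalousDissipation.Theorems.SawtoothPulseCascade.K1Window

open Finset Real
open Summit.AnomalousDissipation.AnomalousDissipation.Theorems.SawtoothPulseCascade.K1Ledger.From

/-- **The trace junk of a dyadic block family**: `Σ_{m<M_b} 3Nσ_m/π²·(2N·T_m) ≤ 6N²r*(4/(3S₀²) + 2/(NS₀))/π²`. [folklore] -/
theorem ctTrace_sum_le {D Q T : ℕ → ℝ} {N S₀ rs : ℝ} (hN : 0 < N) (hS₀ : 0 < S₀) (hS : ∀ m, S₀ * 2 ^ m ≤ D m + Q m)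
    (hT0 : ∀ m, 0 ≤ T m) (hT : ∀ m, T m ≤ rs) (Mb : ℕ) :
    ∑ m ∈ range Mb, 3 * N * (1 / (D m + Q m) ^ 2 + 1 / (N * (D m + Q m))) / π ^ 2 * (2 * N * T m) ≤
      6 * N ^ 2 * rs * (4 / (3 * S₀ ^ 2) + 2 / (N * S₀)) / π ^ 2 := by
  have hπ := Real.pi_pos
  have hrs : 0 ≤ rs := (hT0 0).trans (hT 0)
  -- per block
  have hblk : ∀ m, 3 * N * (1 / (D m + Q m) ^ 2 + 1 / (N * (D m + Q m))) / π ^ 2 * (2 * N * T m) ≤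
      6 * N ^ 2 * rs / π ^ 2 * (1 / S₀ ^ 2 * ((1 / 2 : ℝ) ^ m) ^ 2 + 1 / (N * S₀) * (1 / 2 : ℝ) ^ m) := fun m => by
    have hσs := ctSigma_le hN hS₀ (hS m)
    have hDQ : 0 < D m + Q m := lt_of_lt_of_le (by positivity) (hS m)
    have hσ0 : 0 ≤ 1 / (D m + Q m) ^ 2 + 1 / (N * (D m + Q m)) := by positivity
    have hs0 : 0 ≤ 1 / S₀ ^ 2 * ((1 / 2 : ℝ) ^ m) ^ 2 + 1 / (N * S₀) * (1 / 2 : ℝ) ^ m := hσ0.trans hσs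
    have h := mul_le_mul hσs (hT m) (hT0 m) hs0
    have e1 : 3 * N * (1 / (D m + Q m) ^ 2 + 1 / (N * (D m + Q m))) / π ^ 2 * (2 * N * T m) =
        6 * N ^ 2 / π ^ 2 * ((1 / (D m + Q m) ^ 2 + 1 / (N * (D m + Q m))) * T m) := by ring
    have e2 : 6 * N ^ 2 * rs / π ^ 2 * (1 / S₀ ^ 2 * ((1 / 2 : ℝ) ^ m) ^ 2 + 1 / (N * S₀) * (1 / 2 : ℝ) ^ m) =
        6 * N ^ 2 / π ^ 2 * ((1 / S₀ ^ 2 * ((1 / 2 : ℝ) ^ m) ^ 2 + 1 / (N * S₀) * (1 / 2 : ℝ) ^ m) * rs) := by ring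
    rw [e1, e2]
    exact mul_le_mul_of_nonneg_left h (by positivity)
  -- the two geometric sums
  have hX : ∑ m ∈ range Mb, ((1 / 2 : ℝ) ^ m) ^ 2 ≤ 4 / 3 := by
    have e : ∀ m : ℕ, ((1 / 2 : ℝ) ^ m) ^ 2 = (1 / 4 : ℝ) ^ m := fun m => by
      rw [← pow_mul, mul_comm, pow_mul]; norm_num
    simp_rw [e]; exact sum_range_quarter_pow_le Mb
  have hY : ∑ m ∈ range Mb, (1 / 2 : ℝ) ^ m ≤ 2 := sum_range_half_pow_le Mb
  calc ∑ m ∈ range Mb, 3 * N * (1 / (D m + Q m) ^ 2 + 1 / (N * (D m + Q m))) / π ^ 2 * (2 * N * T m)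
      ≤ ∑ m ∈ range Mb, 6 * N ^ 2 * rs / π ^ 2 * (1 / S₀ ^ 2 * ((1 / 2 : ℝ) ^ m) ^ 2 + 1 / (N * S₀) * (1 / 2 : ℝ) ^ m) :=
        sum_le_sum fun m _ => hblk m
    _ = 6 * N ^ 2 * rs / π ^ 2 * (1 / S₀ ^ 2 * ∑ m ∈ range Mb, ((1 / 2 : ℝ) ^ m) ^ 2 +
          1 / (N * S₀) * ∑ m ∈ range Mb, (1 / 2 : ℝ) ^ m) := by
        rw [← mul_sum, sum_add_distrib, mul_sum, mul_sum]
    _ ≤ 6 * N ^ 2 * rs / π ^ 2 * (1 / S₀ ^ 2 * (4 / 3) + 1 / (N * S₀) * 2) := by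
        refine mul_le_mul_of_nonneg_left (add_le_add (mul_le_mul_of_nonneg_left hX (by positivity))
          (mul_le_mul_of_nonneg_left hY (by positivity))) (by positivity)
    _ = 6 * N ^ 2 * rs * (4 / (3 * S₀ ^ 2) + 2 / (N * S₀)) / π ^ 2 := by
        field_simp

/-- **The residue coefficient of a dyadic block**: gap `D ≥ D₀2^m`, span `D + Q ≥ S₀2^m`, lobe `0 ≤ Q ≤ q₀2^m` give
`12N²Q²(2Q/N+1)σ/(π²D²) ≤ 12N²(q₀/D₀)²(2q₀/(NS₀²) + 2q₀/(N²S₀) + 1/S₀² + 1/(NS₀))/π²` (the lowest block is the worst).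
[folklore] -/
theorem ctResidue_le {D Q N D₀ S₀ q₀ : ℝ} {m : ℕ} (hN : 0 < N) (hD₀ : 0 < D₀) (hS₀ : 0 < S₀) (hq₀ : 0 ≤ q₀)
    (hD : D₀ * 2 ^ m ≤ D) (hS : S₀ * 2 ^ m ≤ D + Q) (hQ0 : 0 ≤ Q) (hQ : Q ≤ q₀ * 2 ^ m) :
    12 * N ^ 2 * Q ^ 2 * (2 * Q / N + 1) * (1 / (D + Q) ^ 2 + 1 / (N * (D + Q))) / (π ^ 2 * D ^ 2) ≤
      12 * N ^ 2 * (q₀ / D₀) ^ 2 * (2 * q₀ / (N * S₀ ^ 2) + 2 * q₀ / (N ^ 2 * S₀) + 1 / S₀ ^ 2 + 1 / (N * S₀)) / π ^ 2 := by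
  have hπ := Real.pi_pos
  have hN0 : N ≠ 0 := hN.ne'
  have hS0 : S₀ ≠ 0 := hS₀.ne'
  have hD00 : D₀ ≠ 0 := hD₀.ne'
  have hπ0 : (π : ℝ) ≠ 0 := hπ.ne'
  set σ : ℝ := 1 / (D + Q) ^ 2 + 1 / (N * (D + Q)) with hσ
  set s : ℝ := 1 / S₀ ^ 2 * ((1 / 2 : ℝ) ^ m) ^ 2 + 1 / (N * S₀) * (1 / 2 : ℝ) ^ m with hs
  have hσs : σ ≤ s := ctSigma_le hN hS₀ hS
  have hDQ : 0 < D + Q := lt_of_lt_of_le (by positivity) hS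
  have hσ0 : 0 ≤ σ := by positivity
  have hDpos : 0 < D := lt_of_lt_of_le (by positivity) hD
  have hD0' : D ≠ 0 := hDpos.ne'
  -- the lobe/gap ratio
  have hQD : Q ≤ q₀ / D₀ * D := by
    calc Q ≤ q₀ * 2 ^ m := hQ
      _ = q₀ / D₀ * (D₀ * 2 ^ m) := by field_simp
      _ ≤ q₀ / D₀ * D := mul_le_mul_of_nonneg_left hD (by positivity)
  have hQ2 : Q ^ 2 ≤ (q₀ / D₀) ^ 2 * D ^ 2 := by
    rw [← mul_pow]; exact pow_le_pow_left₀ hQ0 hQD 2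
  have hQD2 : Q ^ 2 / D ^ 2 ≤ (q₀ / D₀) ^ 2 := by
    rw [div_le_iff₀ (by positivity)]; exact hQ2
  -- the geometric factors are at most one
  have hh : (1 / 2 : ℝ) ^ m ≤ 1 := pow_le_one₀ (by norm_num) (by norm_num)
  have hh2 : ((1 / 2 : ℝ) ^ m) ^ 2 ≤ 1 := pow_le_one₀ (by positivity) hh
  have h2m : (2 : ℝ) ^ m * ((1 / 2 : ℝ) ^ m) ^ 2 = (1 / 2 : ℝ) ^ m := by
    rw [sq, ← mul_assoc, ← mul_pow]; norm_num
  have h2m' : (2 : ℝ) ^ m * (1 / 2 : ℝ) ^ m = 1 := by rw [← mul_pow]; norm_num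
  have hfac : (2 * Q / N + 1) * σ ≤ 2 * q₀ / (N * S₀ ^ 2) + 2 * q₀ / (N ^ 2 * S₀) + 1 / S₀ ^ 2 + 1 / (N * S₀) := by
    have hα : 2 * Q / N + 1 ≤ 2 * (q₀ * 2 ^ m) / N + 1 := by
      have := div_le_div_of_nonneg_right (mul_le_mul_of_nonneg_left hQ zero_le_two) hN.le
      linarith
    calc (2 * Q / N + 1) * σ ≤ (2 * (q₀ * 2 ^ m) / N + 1) * s := mul_le_mul hα hσs hσ0 (by positivity)
      _ = 2 * q₀ / (N * S₀ ^ 2) * ((2 : ℝ) ^ m * ((1 / 2 : ℝ) ^ m) ^ 2) +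
            2 * q₀ / (N ^ 2 * S₀) * ((2 : ℝ) ^ m * (1 / 2 : ℝ) ^ m) + s := by
          rw [hs]; ring
      _ = 2 * q₀ / (N * S₀ ^ 2) * (1 / 2 : ℝ) ^ m + 2 * q₀ / (N ^ 2 * S₀) +
            (1 / S₀ ^ 2 * ((1 / 2 : ℝ) ^ m) ^ 2 + 1 / (N * S₀) * (1 / 2 : ℝ) ^ m) := by rw [h2m, h2m', mul_one]
      _ ≤ 2 * q₀ / (N * S₀ ^ 2) * 1 + 2 * q₀ / (N ^ 2 * S₀) + (1 / S₀ ^ 2 * 1 + 1 / (N * S₀) * 1) := by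
          have h1 := mul_le_mul_of_nonneg_left hh (by positivity : (0 : ℝ) ≤ 2 * q₀ / (N * S₀ ^ 2))
          have h2 := mul_le_mul_of_nonneg_left hh2 (by positivity : (0 : ℝ) ≤ 1 / S₀ ^ 2)
          have h3 := mul_le_mul_of_nonneg_left hh (by positivity : (0 : ℝ) ≤ 1 / (N * S₀))
          linarith
      _ = _ := by ring
  have hβ0 : 0 ≤ (2 * Q / N + 1) * σ := mul_nonneg (by positivity) hσ0
  calc 12 * N ^ 2 * Q ^ 2 * (2 * Q / N + 1) * σ / (π ^ 2 * D ^ 2)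
      = 12 * N ^ 2 / π ^ 2 * (Q ^ 2 / D ^ 2) * ((2 * Q / N + 1) * σ) := by
        field_simp
    _ ≤ 12 * N ^ 2 / π ^ 2 * (q₀ / D₀) ^ 2 * (2 * q₀ / (N * S₀ ^ 2) + 2 * q₀ / (N ^ 2 * S₀) + 1 / S₀ ^ 2 + 1 / (N * S₀)) :=
        mul_le_mul (mul_le_mul_of_nonneg_left hQD2 (by positivity)) hfac hβ0 (by positivity)
    _ = _ := by ring

/-- **The rounding coefficient of a dyadic block below the top**: `0 ≤ Λ' ≤ ℓ₀2^{m+1}`, `m < M_b`, `ε ≥ 0`, `N > 0` give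
`(πΛ'ε/N)² ≤ (πℓ₀2^{M_b}ε/N)²`. [folklore] -/
theorem ctRound_le {Λ' N ℓ₀ ε : ℝ} {m Mb : ℕ} (hN : 0 < N) (hε : 0 ≤ ε) (hℓ₀ : 0 ≤ ℓ₀) (hΛ0 : 0 ≤ Λ')
    (hΛ : Λ' ≤ ℓ₀ * 2 ^ (m + 1)) (hm : m < Mb) :
    (π * Λ' * ε / N) ^ 2 ≤ (π * ℓ₀ * 2 ^ Mb * ε / N) ^ 2 := by
  have hπ := Real.pi_pos
  have h2 : (2 : ℝ) ^ (m + 1) ≤ 2 ^ Mb := pow_le_pow_right₀ (by norm_num) (Nat.succ_le_of_lt hm)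
  have hΛ' : Λ' ≤ ℓ₀ * 2 ^ Mb := hΛ.trans (mul_le_mul_of_nonneg_left h2 hℓ₀)
  have h0 : 0 ≤ π * Λ' * ε / N := by positivity
  exact pow_le_pow_left₀ h0 (div_le_div_of_nonneg_right (mul_le_mul_of_nonneg_right
    (by nlinarith [mul_le_mul_of_nonneg_left hΛ' hπ.le]) hε) hN.le) 2

/-- **The zone junk of `M_b` blocks**: `0 ≤ T_m ≤ r*`, `M, δ ≥ 0` give `Σ_{m<M_b} 8Mδ·T_m/π ≤ M_b·(8Mδ·r*/π)`. [folklore] -/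
theorem ctZone_sum_le {T : ℕ → ℝ} {M δ rs : ℝ} (hM : 0 ≤ M) (hδ : 0 ≤ δ) (hT : ∀ m, T m ≤ rs) (Mb : ℕ) :
    ∑ m ∈ range Mb, 8 * M * δ / π * T m ≤ Mb * (8 * M * δ / π * rs) := by
  have hπ := Real.pi_pos
  calc ∑ m ∈ range Mb, 8 * M * δ / π * T m ≤ ∑ _m ∈ range Mb, 8 * M * δ / π * rs :=
        sum_le_sum fun m _ => mul_le_mul_of_nonneg_left (hT m) (by positivity)
    _ = Mb * (8 * M * δ / π * rs) := by rw [sum_const, card_range, nsmul_eq_mul]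

end Summit.AnomalousDissipation.AnomalousDissipation.Theorems.SawtoothPulseCascade.K1Window
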